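import Summits.QuantumAdvantage.QuantumAdvantage.Theorems.NearExactIsExact.Negative.TightTypeTFourteen
import Summits.QuantumAdvantage.QuantumAdvantage.Theorems.CubicForrelationNearExactIsExactFourteenSecondLevelSeven

/-!
# Residual arithmetic and partner costs for THEOREM TypeO121 (NearExactIsExact, disprover gen 25)

Negative/structural lemmas for the crux `CubicForrelation.NearExactIsExact` (item r2), finite slice `n = 14`, used by
`…Negative.TypeOOneTwentyOneFourteen` (a type-O side caps `Φ ≤ 121/128`).
HONEST FRAMING: statements about cubic Boolean functions on 14 bits — NOT summit progress; no violation of `NearExactIsExact`.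

For a type-O side `g` (`W_g = 32u`, all `u(x)` odd) with digits `d₁ = [⌊u/2⌋ odd]`, `d₂ = [⌊u/4⌋ odd]` and residual
`F = u − 4(−1)^f`:
* `to_mod_eight`: `u ≡ 5 − 2[d₁] − 4[d₁ = d₂] (mod 8)` for EVERY odd `u` (the hypothesis `hmod` of `pp_period_pf`; the tree's
  `tt_mod_eight` assumed tightness);
* `to_cost`: the mod-8 representative `F₀ = (1 − 2[d₁])(1 − 4[d₁ = d₂]) ∈ {±1, ±3}` of `F` has `F₀² = 1 + 8[d₁ = d₂]` and
  `F₀² + 2|F − F₀| ≤ F²` (the slack pays for the `ℓ¹` distance);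
* `to_W_residual`: `F̂(y) = 512(−1)^{g(y)} − 4W_f(y)`;
* `to_partner_typeO`, `to_partner_levelSix`: if `|F̂| > 6144` at six frequencies, a type-O partner `f` costs `Σ(v − 4(−1)^g)² > 28672`
  and a level-6 partner costs `Σ(v' − 2(−1)^g)² > 7168`; `to_even_side_levelSix`: an even side above `15/16` of a non-exact pair is
  at level 6 proper (`fo_levelSeven`).

Sources: [this work].  Standard axioms only.
-/

set_option linter.dupNamespace false -- D-0017: single-problem summit ⇒ `QuantumAdvantage.QuantumAdvantage` by design

noncomputable section

namespace Summit.QuantumAdvantage.QuantumAdvantage.Theorems.NearExactIsExact.Negative.TypeOOneTwentyOnePrepFourteen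

open Finset
open Literature.Computability.QuantumComplexity
open Literature.Computability.QuantumComplexity.BuzetChailloux (bxor zeroVec bxor_bxor_cancel_left bxor_zeroVec zeroVec_bxor
  bxor_comm bxor_self signOf_sq)
open Literature.Computability.QuantumComplexity.DerivativeWalsh (W dwt sum_W_sq twist_bxor_left sum_char_subspace W_mul_W_bxor)
open Summit.QuantumAdvantage.QuantumAdvantage.Theorems.CubicForrelation.NearExactIsExact
open Summit.QuantumAdvantage.QuantumAdvantage.Theorems.SignedCubicForrelationNotPrBPP.Negative.HalfQuad (forrelation_comm)
open Summit.QuantumAdvantage.QuantumAdvantage.Theorems.NearExactIsExact.Negative.TightTypeTFourteen (tt_dual)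

variable {n : ℕ}

/-! ### Arithmetic of the type-O residual -/

/-- The mod-8 congruence of a type-O value in digit form: for odd `u`, `u ≡ 5 − 2[d₁] − 4[d₁ = d₂] (mod 8)` where
`d₁ = [⌊u/2⌋ odd]`, `d₂ = [⌊u/4⌋ odd]` (binary expansion).  This is the hypothesis `hmod` of `pp_period_pf`, here for EVERY
type-O side (the tree's `tt_mod_eight` assumed tightness). [folklore] -/
theorem to_mod_eight (u : ℤ) (hu : Odd u) :
    (8 : ℤ) ∣ u - 5 + 2 * (if decide (Odd (u / 2)) = true then 1 else 0 : ℤ) +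
      4 * (if decide (Odd (u / 2) ↔ Odd (u / 2 / 2)) = true then 1 else 0 : ℤ) := by
  simp only [decide_eq_true_iff]
  rw [Int.odd_iff] at hu
  by_cases h1 : Odd (u / 2) <;> by_cases h2 : Odd (u / 2 / 2) <;>
    simp only [h1, h2, if_true, if_false, iff_true, iff_false, not_true] <;>
    rw [Int.odd_iff] at h1 h2 <;> omega

/-- The mod-8 representative `F₀ ∈ {±1, ±3}` of the residual `u − 4s` (`u` odd, `s = ±1`) in digit form, its square
`F₀² = 1 + 8[d₁ = d₂]`, and the cost inequality `F₀² + 2|u − 4s − F₀| ≤ (u − 4s)²`. [folklore] -/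
theorem to_cost (u s : ℤ) (hu : Odd u) (hs : s = 1 ∨ s = -1) :
    ((1 - 2 * (if Odd (u / 2) then 1 else 0 : ℤ)) * (1 - 4 * (if (Odd (u / 2) ↔ Odd (u / 2 / 2)) then 1 else 0 : ℤ))) ^ 2
        = 1 + 8 * (if (Odd (u / 2) ↔ Odd (u / 2 / 2)) then 1 else 0 : ℤ) ∧
    ((1 - 2 * (if Odd (u / 2) then 1 else 0 : ℤ)) * (1 - 4 * (if (Odd (u / 2) ↔ Odd (u / 2 / 2)) then 1 else 0 : ℤ))) ^ 2
        + 2 * |u - 4 * s - (1 - 2 * (if Odd (u / 2) then 1 else 0 : ℤ)) *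
            (1 - 4 * (if (Odd (u / 2) ↔ Odd (u / 2 / 2)) then 1 else 0 : ℤ))| ≤ (u - 4 * s) ^ 2 := by
  rw [Int.odd_iff] at hu
  -- `u - 4s - F₀ = 8j`
  have key : ∀ r j : ℤ, (r = 1 ∨ r = -1 ∨ r = 3 ∨ r = -3) → r ^ 2 + 2 * |8 * j| ≤ (r + 8 * j) ^ 2 := by
    intro r j hr
    have hjj : |j| ≤ j ^ 2 := by rw [Int.abs_eq_natAbs]; exact Int.natAbs_le_self_sq j
    rw [abs_mul, abs_of_pos (by norm_num : (0 : ℤ) < 8)]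
    rcases hr with rfl | rfl | rfl | rfl <;> rcases le_or_gt 0 j with hj | hj
    · rw [abs_of_nonneg hj] at hjj ⊢; nlinarith
    · rw [abs_of_neg hj] at hjj ⊢; nlinarith
    · rw [abs_of_nonneg hj] at hjj ⊢; nlinarith
    · rw [abs_of_neg hj] at hjj ⊢; nlinarith
    · rw [abs_of_nonneg hj] at hjj ⊢; nlinarith
    · rw [abs_of_neg hj] at hjj ⊢; nlinarith
    · rw [abs_of_nonneg hj] at hjj ⊢; nlinarith
    · rw [abs_of_neg hj] at hjj ⊢; nlinarith
  by_cases h1 : Odd (u / 2) <;> by_cases h2 : Odd (u / 2 / 2) <;>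
    simp only [h1, h2, if_true, if_false, iff_true, iff_false, not_true] <;>
    rw [Int.odd_iff] at h1 h2 <;> refine ⟨by norm_num, ?_⟩
  · -- d₁ = d₂ = 1: F₀ = 3·(… ) : u ≡ 7 (mod 8), u - 4s ≡ 3
    obtain ⟨j, hj⟩ : ∃ j : ℤ, u - 4 * s - (1 - 2 * 1) * (1 - 4 * 1) = 8 * j := by
      rcases hs with rfl | rfl
      · exact ⟨(u - 4 - 3) / 8, by omega⟩
      · exact ⟨(u + 4 - 3) / 8, by omega⟩
    have e : u - 4 * s = (1 - 2 * 1) * (1 - 4 * 1) + 8 * j := by linarith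
    rw [hj, e]
    exact key _ j (by norm_num)
  · -- d₁ = 1, d₂ = 0: F₀ = -1
    obtain ⟨j, hj⟩ : ∃ j : ℤ, u - 4 * s - (1 - 2 * 1) * (1 - 4 * 0) = 8 * j := by
      rcases hs with rfl | rfl
      · exact ⟨(u - 4 + 1) / 8, by omega⟩
      · exact ⟨(u + 4 + 1) / 8, by omega⟩
    have e : u - 4 * s = (1 - 2 * 1) * (1 - 4 * 0) + 8 * j := by linarith
    rw [hj, e]
    exact key _ j (by norm_num)
  · -- d₁ = 0, d₂ = 1: F₀ = 1
    obtain ⟨j, hj⟩ : ∃ j : ℤ, u - 4 * s - (1 - 2 * 0) * (1 - 4 * 0) = 8 * j := by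
      rcases hs with rfl | rfl
      · exact ⟨(u - 4 - 1) / 8, by omega⟩
      · exact ⟨(u + 4 - 1) / 8, by omega⟩
    have e : u - 4 * s = (1 - 2 * 0) * (1 - 4 * 0) + 8 * j := by linarith
    rw [hj, e]
    exact key _ j (by norm_num)
  · -- d₁ = d₂ = 0: F₀ = -3
    obtain ⟨j, hj⟩ : ∃ j : ℤ, u - 4 * s - (1 - 2 * 0) * (1 - 4 * 1) = 8 * j := by
      rcases hs with rfl | rfl
      · exact ⟨(u - 4 + 3) / 8, by omega⟩
      · exact ⟨(u + 4 + 3) / 8, by omega⟩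
    have e : u - 4 * s = (1 - 2 * 0) * (1 - 4 * 1) + 8 * j := by linarith
    rw [hj, e]
    exact key _ j (by norm_num)

/-- **Transform of the type-O residual.**  If `W_g = 32u` then the transform of `F = u − 4(−1)^f` is
`F̂(y) = 512(−1)^{g(y)} − 4W_f(y)` (Fourier inversion; the tree's `tt_dual` is the case `W_f = 32v`).  NOT summit progress.
[this work] -/
theorem to_W_residual (f g : (Fin (7 + 7) → Bool) → Bool)
    (u : (Fin (7 + 7) → Bool) → ℤ) (hu : ∀ x, W (fun y => signOf (g y)) x = (2 : ℝ) ^ 5 * (u x : ℝ))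
    (y : Fin (7 + 7) → Bool) :
    W (fun x => ((u x - 4 * sZ (f x) : ℤ) : ℝ)) y = 512 * signOf (g y) - 4 * W (fun x => signOf (f x)) y := by
  have hinv : ∑ x, (u x : ℝ) * twist x y = 512 * signOf (g y) := by
    have h := tz_inversion (fun z => signOf (g z)) y
    rw [sum_congr rfl fun x _ => by rw [hu x]] at h
    have e : ∑ x, (2 : ℝ) ^ 5 * (u x : ℝ) * twist x y = 2 ^ 5 * ∑ x, (u x : ℝ) * twist x y := by
      rw [mul_sum]
      exact sum_congr rfl fun x _ => by ring
    rw [e] at h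
    have h' : (2 : ℝ) ^ 5 * (∑ x, (u x : ℝ) * twist x y - 512 * signOf (g y)) = 0 := by
      rw [mul_sub, h]; ring
    have h2 : (2 : ℝ) ^ 5 ≠ 0 := by positivity
    linarith [(mul_eq_zero.1 h').resolve_left h2]
  unfold W at hinv ⊢
  have e : ∀ x, ((u x - 4 * sZ (f x) : ℤ) : ℝ) * twist x y = (u x : ℝ) * twist x y - 4 * (signOf (f x) * twist x y) := by
    intro x
    push_cast
    rw [tp_sZ_cast]
    ring
  rw [sum_congr rfl fun x _ => e x, sum_sub_distrib, ← mul_sum, hinv]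

/-! ### Partner costs at the six large frequencies -/

/-- **Type-O partner is too expensive.**  If `W_g = 32u`, `W_f = 32v` with all `v(y)` odd, and the residual transform
`F̂ = −128(v − 4(−1)^g)` exceeds `6144` in modulus at the `6` points of `S`, then `Σ_y (v − 4(−1)^g)² ≥ 2¹⁴ + 6·2400 > 28672`.
NOT summit progress. [this work] -/
theorem to_partner_typeO (f g : (Fin (7 + 7) → Bool) → Bool)
    (u : (Fin (7 + 7) → Bool) → ℤ) (hu : ∀ x, W (fun y => signOf (g y)) x = (2 : ℝ) ^ 5 * (u x : ℝ))
    (v : (Fin (7 + 7) → Bool) → ℤ) (hv : ∀ y, W (fun x => signOf (f x)) y = (2 : ℝ) ^ 5 * (v y : ℝ))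
    (hoddv : ∀ y, Odd (v y)) (S : Finset (Fin (7 + 7) → Bool)) (hS : #S = 6)
    (hbig : ∀ y ∈ S, (6144 : ℝ) < |W (fun x => ((u x - 4 * sZ (f x) : ℤ) : ℝ)) y|)
    (hB : (∑ y, (v y - 4 * sZ (g y)) ^ 2 : ℤ) < 28672) : False := by
  classical
  have hpt : ∀ y, (if y ∈ S then 2401 else 1 : ℤ) ≤ (v y - 4 * sZ (g y)) ^ 2 := by
    intro y
    split_ifs with hy
    · have h := hbig y hy
      rw [tt_dual f g u hu v hv y, abs_mul] at h
      norm_num at h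
      have h' : (48 : ℝ) < |((v y - 4 * sZ (g y) : ℤ) : ℝ)| := by push_cast; linarith
      have h'' : (48 : ℤ) < |v y - 4 * sZ (g y)| := by exact_mod_cast h'
      have h49 : (49 : ℤ) ≤ |v y - 4 * sZ (g y)| := by linarith
      nlinarith [sq_abs (v y - 4 * sZ (g y)), mul_le_mul h49 h49 (by norm_num) (abs_nonneg _)]
    · have hne : v y - 4 * sZ (g y) ≠ 0 := by
        obtain ⟨k, hk⟩ := hoddv y
        rcases tp_sZ_cases (g y) with hs | hs <;> omega
      nlinarith [sq_abs (v y - 4 * sZ (g y)), Int.one_le_abs hne, abs_nonneg (v y - 4 * sZ (g y))]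
  have hsum := sum_le_sum fun y (_ : y ∈ (univ : Finset (Fin (7 + 7) → Bool))) => hpt y
  have hf : univ.filter (fun y => y ∈ S) = S := by ext y; simp
  have hL : ∑ y, (if y ∈ S then 2401 else 1 : ℤ) = 30784 := by
    have e : ∀ y, (if y ∈ S then 2401 else 1 : ℤ) = 1 + (if y ∈ S then 2400 else 0 : ℤ) := by
      intro y; split_ifs <;> norm_num
    rw [sum_congr rfl fun y _ => e y, sum_add_distrib, ← sum_filter, hf, sum_const, sum_const, card_univ, hS,
      Fintype.card_fun, Fintype.card_bool, Fintype.card_fin]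
    simp only [nsmul_eq_mul]
    norm_num
  rw [hL] at hsum
  linarith

/-- **Level-6 partner is too expensive.**  If `W_g = 32u`, `W_f = 64v'` with some `v'(y)` odd (`f` cubic), and the residual
transform `F̂ = −256(v' − 2(−1)^g)` exceeds `6144` in modulus at the `6` points of `S`, then
`Σ_y (v' − 2(−1)^g)² ≥ #{v' odd} + 6·624 ≥ 2¹² + 3744 > 7168` (`{v' odd}` is a non-zero quadratic, T).
NOT summit progress. [this work] -/
theorem to_partner_levelSix (f g : (Fin (7 + 7) → Bool) → Bool) (hf : IsDegLeFun 3 f)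
    (u : (Fin (7 + 7) → Bool) → ℤ) (hu : ∀ x, W (fun y => signOf (g y)) x = (2 : ℝ) ^ 5 * (u x : ℝ))
    (v' : (Fin (7 + 7) → Bool) → ℤ) (hv' : ∀ y, W (fun x => signOf (f x)) y = (2 : ℝ) ^ 6 * (v' y : ℝ))
    (hodd : ∃ y, Odd (v' y)) (S : Finset (Fin (7 + 7) → Bool)) (hS : #S = 6)
    (hbig : ∀ y ∈ S, (6144 : ℝ) < |W (fun x => ((u x - 4 * sZ (f x) : ℤ) : ℝ)) y|)
    (hB : (∑ y, (v' y - 2 * sZ (g y)) ^ 2 : ℤ) < 7168) : False := by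
  classical
  have hdeg : IsDegLeFun 2 (fun y => decide (Odd (v' y))) :=
    stub_walshTower stub_axParity (7 + 7) 6 2 f v' hf hv' (by intro k hk hkn; omega)
  have hne : ∃ y, decide (Odd (v' y)) = true := by
    obtain ⟨y, hy⟩ := hodd
    exact ⟨y, decide_eq_true hy⟩
  have hrm : 2 ^ (7 + 7) ≤ 2 ^ 2 * #(univ.filter fun y : Fin (7 + 7) → Bool => decide (Odd (v' y)) = true) :=
    bb_rmWeight_holds (7 + 7) 2 _ hdeg hne
  have hPge : (4096 : ℤ) ≤ #(univ.filter fun y : Fin (7 + 7) → Bool => decide (Odd (v' y)) = true) := by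
    have h14 : (2 : ℕ) ^ (7 + 7) = 16384 := by norm_num
    have h2 : (2 : ℕ) ^ 2 = 4 := by norm_num
    rw [h14, h2] at hrm
    omega
  have hWF : ∀ y, W (fun x => ((u x - 4 * sZ (f x) : ℤ) : ℝ)) y = -256 * ((v' y - 2 * sZ (g y) : ℤ) : ℝ) := by
    intro y
    rw [to_W_residual f g u hu y, hv' y]
    push_cast
    rw [← tp_sZ_cast (g y)]
    ring
  have hpt : ∀ y, (if decide (Odd (v' y)) = true then 1 else 0 : ℤ) + (if y ∈ S then 624 else 0 : ℤ) ≤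
      (v' y - 2 * sZ (g y)) ^ 2 := by
    intro y
    by_cases hy : y ∈ S
    · rw [if_pos hy]
      have h := hbig y hy
      rw [hWF y, abs_mul] at h
      norm_num at h
      have h' : (24 : ℝ) < |((v' y - 2 * sZ (g y) : ℤ) : ℝ)| := by push_cast; linarith
      have h'' : (24 : ℤ) < |v' y - 2 * sZ (g y)| := by exact_mod_cast h'
      have h25 : (25 : ℤ) ≤ |v' y - 2 * sZ (g y)| := by linarith
      have hsq : (625 : ℤ) ≤ (v' y - 2 * sZ (g y)) ^ 2 := by
        nlinarith [sq_abs (v' y - 2 * sZ (g y)), mul_le_mul h25 h25 (by norm_num) (abs_nonneg _)]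
      split_ifs <;> linarith
    · rw [if_neg hy, add_zero]
      split_ifs with ho
      · have ho' : Odd (v' y) := of_decide_eq_true ho
        have hne' : v' y - 2 * sZ (g y) ≠ 0 := by
          obtain ⟨k, hk⟩ := ho'
          rcases tp_sZ_cases (g y) with hs | hs <;> omega
        nlinarith [sq_abs (v' y - 2 * sZ (g y)), Int.one_le_abs hne', abs_nonneg (v' y - 2 * sZ (g y))]
      · positivity
  have hsum := sum_le_sum fun y (_ : y ∈ (univ : Finset (Fin (7 + 7) → Bool))) => hpt y
  have hf' : univ.filter (fun y => y ∈ S) = S := by ext y; simp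
  have hS624 : ∑ y, (if y ∈ S then 624 else 0 : ℤ) = 3744 := by
    rw [← sum_filter, hf', sum_const, hS]
    simp only [nsmul_eq_mul]
    norm_num
  rw [sum_add_distrib, sum_boole, hS624] at hsum
  linarith

/-! ### Even sides above `15/16` -/

/-- An even side of a non-exact cubic pair above `15/16` is at level 6 proper (`W_g = 64u'`, some `u'(x)` odd): level `≥ 7`
would give `Φ = 1` or the bent value `15/16` (`fo_levelSeven`).  NOT summit progress. [this work] -/
theorem to_even_side_levelSix (f g : (Fin (7 + 7) → Bool) → Bool) (hf : IsDegLeFun 3 f) (hg : IsDegLeFun 3 g)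
    (hΦ : (15 / 16 : ℝ) < forrelation f g) (hne : forrelation f g ≠ 1)
    (u : (Fin (7 + 7) → Bool) → ℤ) (hu : ∀ x, W (fun y => signOf (g y)) x = (2 : ℝ) ^ 5 * (u x : ℝ))
    (hev : ∃ x, ¬ Odd (u x)) :
    ∃ u' : (Fin (7 + 7) → Bool) → ℤ, (∀ x, W (fun y => signOf (g y)) x = (2 : ℝ) ^ 6 * (u' x : ℝ)) ∧ ∃ x, Odd (u' x) := by
  obtain ⟨x₀, hx₀⟩ := hev
  have hev' : ∀ x, ¬ Odd (u x) := fun x h => hx₀ ((fd_parity_const g u hg hu x x₀).1 h)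
  have hu6 := tw_level_up g u hu hev'
  by_cases h6 : ∃ x, Odd (u x / 2)
  · exact ⟨fun x => u x / 2, hu6, h6⟩
  · push Not at h6
    have hu7 := tw_level_up g (fun x => u x / 2) hu6 h6
    rcases fo_levelSeven f g hf hg _ hu7 hΦ.le with h | h
    · exact absurd h hne
    · exfalso
      linarith [h.2]


end Summit.QuantumAdvantage.QuantumAdvantage.Theorems.NearExactIsExact.Negative.TypeOOneTwentyOnePrepFourteen

end
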